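/- Copyright: ym3-torus cell, WIDTH-5 ATTACH seat `ym-ust-19936-w4` (prover, g10), for crux `HistoryTailL` (stmt-QuantumFields-19936),
level-0 prefactor-free infrastructure (T4-UP, brick U1a) of LINE `local_insertion` (#13) ∕ K1.  Released under the licence of the surrounding project. -/
import Summits.QuantumFields.YangMills.Theorems.LangevinControlUVFemtoCurvatureTwoPointCTorusTopLinkSharp
import HarnessLib

/-!
# (T4-UP, U1a) The top-link assignment on the THREE-torus (`#P = 2L³ − L² − L`) — d = 3 port of ✓`…CTorusTopLink`

Support file (`--supports stmt-QuantumFields-19936 --as helper`), cell ym3-torus level-0 programme, stage (T4) «uniform doubling»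
(LEAD ★w1-19936 g7 00:35:51Z ∕ 00:47:49Z; split ★w7 = T4-LOW, ★w4 = T4-UP).  This is the `d = 3` twin, letter for letter, of
the route-`LangevinControlUV` file ✓`LangevinControlUVFemtoCurvatureTwoPointCTorusTopLink` (crux 16204, `d = 4` hard-wired):
for `L ≥ 2` a family `P` of `2L³ − L² − L` plaquettes of `(ℤ∕L)³`, an assignment `top` of one of its four links to each
member, injective on `P`, and an injective rank on links with `top p` of maximal rank among the links of `p`
(`torus_topLink_assignment_d3`).  The SHARP family (`2L³ − 2` members) is the sequel U1b; the triangular integration that consumes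
it is ✓`LocalInsertionTriangularHaarIntegration` ∕ ✓`…CTorusUpperAxis.lintegral_mul_prod_le_pow_mul_lintegral` (generic).

HONEST SCOPE.  Finite combinatorics (Mathlib `ZMod`, `Fin`, `Finset.card`, `Fintype.piFinset`); no measure, no estimate of
Bałaban's papers; nothing of (T4), of LINE #13's stubs, of `HistoryTailL` or of any crux is proved.  YM₃ on T³ is rung R3 — not
d = 4, not infinite volume, not a mass gap, not Clay.
-/

set_option autoImplicit false

noncomputable section

open Finset
open Literature.MathematicalPhysics.QuantumFieldTheory

namespace Summit.QuantumFields.YangMills.Theorems.LocalInsertion.TorusTopLinkD3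

open Summit.QuantumFields.YangMills.Theorems.FemtoCurvatureTwoPointC.TorusGauge.TopLink
  (val_one_of_two_le val_add_one_of_lt card_filter_val_succ_lt)

-- adapted from Summits/QuantumFields/YangMills/Theorems/LangevinControlUVFemtoCurvatureTwoPointCTorusTopLink.lean (d = 4 → d = 3)

namespace TopLink

variable {L : ℕ}

/-! ## Arithmetic in `ZMod L` without wrap-around -/

/-- Coordinates of the shifted site `x + e_μ`. -/
theorem shift_apply (x : Site 3 L) (μ i : Fin 3) :
    x.shift μ i = x i + if i = μ then 1 else 0 := by
  simp [Site.shift, Pi.single_apply]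

/-- Key step for injectivity: if `x + e_μ = y + e_ν` where `x_μ` does not wrap and `y_i = 0` for
`i < ν`, then `¬ μ < ν` (evaluate at `μ`: `x_μ + 1 = y_μ = 0` would wrap). -/
theorem not_lt_of_shift_eq (hL : 2 ≤ L) {x y : Site 3 L} {μ ν : Fin 3} (hx : (x μ).val + 1 < L)
    (hy : ∀ i : Fin 3, i < ν → y i = 0) (h : x.shift μ = y.shift ν) : ¬μ < ν := by
  intro hlt
  have h1 := congrFun h μ
  rw [shift_apply, shift_apply, if_pos rfl, if_neg hlt.ne, add_zero, hy μ hlt] at h1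
  have h2 := congrArg ZMod.val h1
  rw [val_add_one_of_lt hL hx, ZMod.val_zero] at h2
  exact Nat.succ_ne_zero _ h2

/-! ## The rank: direction-major, then the base point read as an `L`-adic integer -/

/-- Links of direction `μ < ν` rank below every link of direction `ν`, for any base-point code
`c < L⁴`. -/
theorem rank_le_of_lt {c : Site 3 L → ℕ} (hlt : ∀ x, c x < L ^ 3) (z w : Site 3 L) {μ ν : Fin 3}
    (hμν : μ < ν) : c z + (μ : ℕ) * L ^ 3 ≤ c w + (ν : ℕ) * L ^ 3 := by
  have h1 : (μ : ℕ) + 1 ≤ ν := hμν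
  calc c z + (μ : ℕ) * L ^ 3 ≤ L ^ 3 + (μ : ℕ) * L ^ 3 := Nat.add_le_add_right (hlt z).le _
    _ = ((μ : ℕ) + 1) * L ^ 3 := by ring
    _ ≤ (ν : ℕ) * L ^ 3 := Nat.mul_le_mul_right _ h1
    _ ≤ c w + (ν : ℕ) * L ^ 3 := Nat.le_add_left _ _

/-- **Maximal rank.** If the base-point code `c < L⁴` grows by `L^μ` under a non-wrapping shift in
direction `μ`, then for a plaquette `p = (x; μ < ν)` whose `μ`-th coordinate does not wrap, every one of
its four links has rank `c · + dir · L⁴` at most that of the link `(x + e_μ, ν)`. -/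
theorem rank_le_rank_top {c : Site 3 L → ℕ} (hlt : ∀ x, c x < L ^ 3)
    (hshift : ∀ (x : Site 3 L) (μ : Fin 3), (x μ).val + 1 < L → c (x.shift μ) = c x + L ^ (μ : ℕ))
    {p : Plaquette 3 L} (hp : (p.1 p.2.1.1).val + 1 < L) :
    ∀ e ∈ ({(p.1, p.2.1.1), (p.1.shift p.2.1.1, p.2.1.2), (p.1.shift p.2.1.2, p.2.1.1),
      (p.1, p.2.1.2)} : Finset (Edge 3 L)),
      c e.1 + (e.2 : ℕ) * L ^ 3 ≤ c (p.1.shift p.2.1.1) + (p.2.1.2 : ℕ) * L ^ 3 := by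
  obtain ⟨x, ⟨⟨μ, ν⟩, hμν⟩⟩ := p
  intro e he
  simp only [Finset.mem_insert, Finset.mem_singleton] at he
  rcases he with rfl | rfl | rfl | rfl
  · exact rank_le_of_lt hlt x _ hμν
  · exact le_rfl
  · exact rank_le_of_lt hlt _ _ hμν
  · show c x + (ν : ℕ) * L ^ 3 ≤ c (x.shift μ) + (ν : ℕ) * L ^ 3
    rw [hshift x μ hp]
    exact Nat.add_le_add_right (Nat.le_add_right _ _) _

variable [NeZero L]

/-- **The base-point code.** There is an injective `c : Site → ℕ` with `c < L⁴` that grows by `L^μ`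
under a non-wrapping shift in direction `μ`: `c x = x₀ + x₁ L + x₂ L² + x₃ L³` (coordinates read as
naturals `< L`; Mathlib's `finFunctionFinEquiv`). -/
theorem exists_coord (hL : 2 ≤ L) :
    ∃ c : Site 3 L → ℕ, Function.Injective c ∧ (∀ x, c x < L ^ 3) ∧
      ∀ (x : Site 3 L) (μ : Fin 3), (x μ).val + 1 < L → c (x.shift μ) = c x + L ^ (μ : ℕ) := by
  obtain ⟨dg, hdg⟩ : ∃ dg : Site 3 L → Fin 3 → Fin L, ∀ x i, ((dg x i : Fin L) : ℕ) = (x i).val :=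
    ⟨fun x i => ⟨(x i).val, ZMod.val_lt (x i)⟩, fun _ _ => rfl⟩
  have hdg_inj : Function.Injective dg := fun x y h =>
    funext fun i => ZMod.val_injective L (by rw [← hdg x i, ← hdg y i, h])
  refine ⟨fun x => (finFunctionFinEquiv (dg x) : ℕ),
    fun _ _ h => hdg_inj (finFunctionFinEquiv.injective (Fin.ext h)),
    fun x => (finFunctionFinEquiv (dg x)).isLt, fun x μ hx => ?_⟩
  have key : ∀ i : Fin 3, (x.shift μ i).val = (x i).val + if i = μ then 1 else 0 := by
    intro i
    rw [shift_apply]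
    by_cases h : i = μ
    · subst h
      rw [if_pos rfl, if_pos rfl]
      exact val_add_one_of_lt hL hx
    · rw [if_neg h, if_neg h, add_zero, add_zero]
  show (finFunctionFinEquiv (dg (x.shift μ)) : ℕ) = (finFunctionFinEquiv (dg x) : ℕ) + L ^ (μ : ℕ)
  simp only [finFunctionFinEquiv_apply, hdg, key, add_mul, Finset.sum_add_distrib, ite_mul, one_mul,
    zero_mul, Finset.sum_ite_eq', Finset.mem_univ, if_true]

/-- **Injectivity of the rank** `rk (x, μ) = c x + μ L⁴` for an injective code `c < L⁴` (a mixed-radix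
expansion). -/
theorem rank_injective {c : Site 3 L → ℕ} (hinj : Function.Injective c) (hlt : ∀ x, c x < L ^ 3) :
    Function.Injective fun e : Edge 3 L => c e.1 + (e.2 : ℕ) * L ^ 3 := by
  rintro ⟨x, μ⟩ ⟨y, ν⟩ h
  have hT : 0 < L ^ 3 := pow_pos (Nat.pos_of_ne_zero (NeZero.ne L)) 3
  have hdiv : ∀ (z : Site 3 L) (k : ℕ), (c z + k * L ^ 3) / L ^ 3 = k := fun z k => by
    rw [Nat.add_mul_div_right _ _ hT, Nat.div_eq_of_lt (hlt z), zero_add]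
  have hmod : ∀ (z : Site 3 L) (k : ℕ), (c z + k * L ^ 3) % L ^ 3 = c z := fun z k => by
    rw [Nat.add_mul_mod_self_right, Nat.mod_eq_of_lt (hlt z)]
  have hμν : (μ : ℕ) = ν := (hdiv x μ).symm.trans ((congrArg (· / L ^ 3) h).trans (hdiv y ν))
  have hxy : c x = c y := (hmod x μ).symm.trans ((congrArg (· % L ^ 3) h).trans (hmod y ν))
  exact Prod.ext (hinj hxy) (Fin.ext hμν)

/-! ## The family: boxes of base points, injectivity of the assignment, and the count -/

/-- **The boxes of base points.** For each first direction `μ` the base points `x` with `x_μ + 1 < L`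
(as naturals) and `x_i = 0` for `i < μ` form a box (`Fintype.piFinset` of the slots `{0}` for `i < μ`,
`{a : a.val + 1 < L}` for `i = μ`, everything for `i > μ`) of size `∏ᵢ #slotᵢ`, `#slotᵢ ∈ {1, L − 1, L}`. -/
theorem exists_boxes : ∃ B : Fin 3 → Finset (Site 3 L),
    (∀ (μ : Fin 3) (x : Site 3 L), x ∈ B μ ↔ (x μ).val + 1 < L ∧ ∀ i : Fin 3, i < μ → x i = 0) ∧
    ∀ μ : Fin 3, (B μ).card = ∏ i : Fin 3, (if i < μ then 1 else if i = μ then L - 1 else L) := by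
  refine ⟨fun μ => Fintype.piFinset fun i => if i < μ then {0} else
      if i = μ then univ.filter (fun a : ZMod L => a.val + 1 < L) else univ, fun μ x => ?_, fun μ => ?_⟩
  · rw [Fintype.mem_piFinset]
    constructor
    · intro h
      refine ⟨?_, fun i hi => ?_⟩
      · have hμ := h μ
        simp only [lt_self_iff_false, if_false, if_true, Finset.mem_filter, Finset.mem_univ,
          true_and] at hμ
        exact hμ
      · have := h i
        simp only [if_pos hi, Finset.mem_singleton] at this
        exact this
    · rintro ⟨h1, h2⟩ i
      split_ifs with hi hi'
      · exact Finset.mem_singleton.2 (h2 i hi)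
      · subst hi'
        exact Finset.mem_filter.2 ⟨Finset.mem_univ _, h1⟩
      · exact Finset.mem_univ _
  · rw [Fintype.card_piFinset]
    refine Finset.prod_congr rfl fun i _ => ?_
    split_ifs
    · rfl
    · exact card_filter_val_succ_lt
    · rw [Finset.card_univ, ZMod.card]

omit [NeZero L] in
/-- **Injectivity of the assignment** `(x; μ, ν) ↦ (x + e_μ, ν)` on the family of plaquettes whose base
point lies in the box of its first direction. -/
theorem injOn_top [Fintype (Site 3 L)] (hL : 2 ≤ L) {B : Fin 3 → Finset (Site 3 L)}
    (hB : ∀ (μ : Fin 3) (x : Site 3 L), x ∈ B μ ↔ (x μ).val + 1 < L ∧ ∀ i : Fin 3, i < μ → x i = 0) :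
    Set.InjOn (fun p : Plaquette 3 L => (p.1.shift p.2.1.1, p.2.1.2))
      ↑(univ.filter fun p : Plaquette 3 L => p.1 ∈ B p.2.1.1) := by
  rintro ⟨x, ⟨⟨μ, ν⟩, hμν⟩⟩ hx ⟨y, ⟨⟨μ', ν'⟩, hμν'⟩⟩ hy h
  simp only [Finset.coe_filter, Finset.mem_univ, true_and, Set.mem_setOf_eq, hB] at hx hy
  simp only [Prod.mk.injEq] at h
  obtain ⟨h1, rfl⟩ := h
  have hμ : μ = μ' :=
    le_antisymm (not_lt.1 (not_lt_of_shift_eq hL hy.1 hx.2 h1.symm))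
      (not_lt.1 (not_lt_of_shift_eq hL hx.1 hy.2 h1))
  subst hμ
  have hxy : x = y := add_right_cancel (h1 : x + Pi.single μ 1 = y + Pi.single μ 1)
  subst hxy
  rfl

/-- **Count.** If the box for first direction `μ` has `∏ᵢ #slotᵢ` elements (`1`, `L − 1`, `L` for
`i < μ`, `i = μ`, `i > μ`), the family has `3 (L−1) L³ + 2 (L−1) L² + (L−1) L = 3L⁴ − L³ − L² − L` members:
`#P + (L³ + L² + L) = 3L⁴`. -/
theorem card_family {B : Fin 3 → Finset (Site 3 L)}
    (hB : ∀ μ : Fin 3, (B μ).card = ∏ i : Fin 3, (if i < μ then 1 else if i = μ then L - 1 else L)) :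
    (univ.filter fun p : Plaquette 3 L => p.1 ∈ B p.2.1.1).card + (L ^ 2 + L) = 2 * L ^ 3 := by
  have h1 : (univ.filter fun p : Plaquette 3 L => p.1 ∈ B p.2.1.1).card =
      ∑ q : {q : Fin 3 × Fin 3 // q.1 < q.2},
        ∏ i : Fin 3, (if i < q.1.1 then 1 else if i = q.1.1 then L - 1 else L) := by
    calc (univ.filter fun p : Plaquette 3 L => p.1 ∈ B p.2.1.1).card
          = ∑ p : Plaquette 3 L, if p.1 ∈ B p.2.1.1 then 1 else 0 := Finset.card_filter _ _
      _ = ∑ q : {q : Fin 3 × Fin 3 // q.1 < q.2}, ∑ x : Site 3 L, if x ∈ B q.1.1 then 1 else 0 :=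
          Fintype.sum_prod_type_right _
      _ = ∑ q : {q : Fin 3 × Fin 3 // q.1 < q.2}, (B q.1.1).card :=
          Finset.sum_congr rfl fun q _ => by rw [Finset.sum_ite_mem_eq, Finset.card_eq_sum_ones]
      _ = _ := Finset.sum_congr rfl fun q _ => hB _
  rw [h1, ← Finset.sum_subtype (p := fun q : Fin 3 × Fin 3 => q.1 < q.2)
    (univ.filter fun q : Fin 3 × Fin 3 => q.1 < q.2) (fun _ => by simp)
    (fun q : Fin 3 × Fin 3 => ∏ i : Fin 3, (if i < q.1 then 1 else if i = q.1 then L - 1 else L)),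
    Finset.sum_filter]
  simp only [Fintype.sum_prod_type, Fin.sum_univ_three, Fin.prod_univ_three]
  simp
  obtain ⟨M, rfl⟩ : ∃ M, L = M + 1 := ⟨L - 1, (Nat.succ_pred_eq_of_ne_zero (NeZero.ne L)).symm⟩
  simp only [Nat.add_sub_cancel]
  ring

end TopLink

/-! ## The registered statement -/

/-- **Top-link assignment on the 3-torus.** For `L ≥ 2` there are a family `P` of `2L³ − L² − L` plaquettes, a map
`top` assigning to each of them one of its four links, and an injective rank on links (direction-major, then
positional in the base-point coordinates `x₀, x₁, x₂, x₃` read as naturals) such that `top` is injective on `P` and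
`top p` has maximal rank among the four links of `p`. (Take `rk (x, μ) = μL⁴ + x₀ + x₁L + x₂L² + x₃L³`,
`P = {(x; μ < ν) : x_μ ≠ L − 1, x_{μ'} = 0 ∀ μ' < μ}`, `top (x; μ, ν) = (x + e_μ, ν)`; see
`TopLink.exists_coord`, `TopLink.exists_boxes`, `TopLink.rank_injective`, `TopLink.injOn_top`,
`TopLink.card_family`, `TopLink.rank_le_rank_top`.) -/
theorem torus_topLink_assignment_d3 : ∀ (L : ℕ) [NeZero L], 2 ≤ L →
    ∃ (P : Finset (Plaquette 3 L)) (top : Plaquette 3 L → Edge 3 L) (rk : Edge 3 L → ℕ),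
      Function.Injective rk ∧ Set.InjOn top ↑P ∧ P.card + (L ^ 2 + L) = 2 * L ^ 3 ∧
      ∀ p ∈ P,
        top p ∈ ({(p.1, p.2.1.1), (p.1.shift p.2.1.1, p.2.1.2), (p.1.shift p.2.1.2, p.2.1.1), (p.1, p.2.1.2)} :
          Finset (Edge 3 L)) ∧
        ∀ e ∈ ({(p.1, p.2.1.1), (p.1.shift p.2.1.1, p.2.1.2), (p.1.shift p.2.1.2, p.2.1.1), (p.1, p.2.1.2)} :
          Finset (Edge 3 L)), rk e ≤ rk (top p) := by
  intro L _ hL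
  obtain ⟨c, hc_inj, hc_lt, hc_shift⟩ := TopLink.exists_coord (L := L) hL
  obtain ⟨B, hB_mem, hB_card⟩ := TopLink.exists_boxes (L := L)
  refine ⟨univ.filter fun p : Plaquette 3 L => p.1 ∈ B p.2.1.1, fun p => (p.1.shift p.2.1.1, p.2.1.2),
    fun e => c e.1 + (e.2 : ℕ) * L ^ 3, TopLink.rank_injective hc_inj hc_lt, TopLink.injOn_top hL hB_mem,
    TopLink.card_family hB_card, fun p hp => ⟨by simp, ?_⟩⟩
  have hp' : (p.1 p.2.1.1).val + 1 < L := by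
    simp only [Finset.mem_filter, Finset.mem_univ, true_and, hB_mem] at hp
    exact hp.1
  exact TopLink.rank_le_rank_top hc_lt hc_shift hp'

end Summit.QuantumFields.YangMills.Theorems.LocalInsertion.TorusTopLinkD3

end
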